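import Literature.AlgebraicGeometry.Frobenioids.Thm49PerfectionDescent
import Literature.AlgebraicGeometry.Frobenioids.Thm49IsotropicWLOG
import HarnessLib

/-!
# [FrdI] Thm. 4.9, p. 89: the descents of `Ψ^Φ` along `Φ ↪ Φ^pf` and along the isotropic hulls, WITH their
# defining equations (and the Div clause they carry)

Mochizuki, *The geometry of Frobenioids I: the general theory*, Kyushu J. Math. **62** (2008)
293–400, §4, proof of Theorem 4.9, kurims text p. 89 ll. 3–5 ("we may assume without loss of generality
that `C₁`, `C₂` are of isotropic type … perfect type") and ll. 25–41 ("[`Ψ^pf`] maps the subset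
`Φ₁(A₁) ⊆ Φ₁(A₁)^pf` onto the subset `Φ₂(A₂)`, hence determines an isomorphism of monoids `Φ₁(A₁) ⥲ Φ₂(A₂)`
which is functorial in `A₁`") [cite: MochizukiFrdI2008, Thm. 4.9 p.89].

PROOF-ONLY file (seat abc-iut-L1-t14; rows `FrdI:Cor4.11(iii)/(iv)` general case, and the C-level
`Thm49_compat` of row T49-compat-C). The two descent steps of the tree —
`PreFrobenioidData.DivisorMonoidIsoOver.nonempty_of_embedding` / `FrdI.T49.nonempty_divisorMonoidIsoOver_of_perfection`
(seat abc-iut-w4-d109, `DivisorMonoidIsoEmbeddingDescent.lean`, `Thm49PerfectionDescent.lean`) and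
`FrdI.T49.nonempty_divisorMonoidIsoOver_of_isotropic` (seat abc-iut-w4-d109, `Thm49IsotropicWLOG.lean`, row
T49-L01) — conclude `Nonempty`; the consumers of Cor. 4.11 (iv) ("`Div(Ψ φ) = Ψ^Φ(Div φ)`") and of the
compatibility clause of Thm. 4.9 / Cor. 4.11 (iii) need the descended `Ψ^Φ` TOGETHER WITH ITS DEFINING
EQUATION. This file re-runs the same constructions (proofs adapted from the files named, verbatim where
possible) with the equations as conclusions:

* `DivisorMonoidIsoOver.exists_of_embedding` — generic: `(g_A)^* ι₂(Ψ^Φ_A x) = E'_{I₁ A}((b_A)^* ι₁ x)`;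
* `FrdI.T49.exists_divisorMonoidIsoOver_of_perfection` — along `Φ_i ↪ Φ_i^pf`:
  `(Ψ^Φ_A x)^{1/1} = E'_{(A,1)}(x^{1/1})`, and hence the Div clause `Ψ^Φ_A(Div φ) = Div(Ψ φ)` on pre-steps
  of `C₁` from the one of `E'` on pre-steps of `C₁^pf`;
* `FrdI.T49.exists_divisorMonoidIsoOver_of_isotropic` — along the isotropic hulls: the extension AGREES with
  the given family `m` on the isotropic objects; `FrdI.T49.iso_div_of_agree_isotropic` — hence the Div clause
  on pre-steps of `C₁` from the one of `m` on pre-steps between isotropic objects (`Div(f^istr) =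
  (Base hull_A)⁻¹^* Div(f)`, Prop. 1.9 (v); hulls are isometric pre-steps, Def. 1.3 (vii)).
No new definitions; nothing of the paper is restated; nothing here bears on [IUTchIII] Cor. 3.12.
-/

namespace Literature.AlgebraicGeometry.Frobenioids

open CategoryTheory Opposite

universe w₁ w₂ w₁' w₂' v₁ v₁' v₂ v₂' u₁ u₁' u₂ u₂' v₃ u₃ v₄ u₄

namespace PreFrobenioidData

namespace DivisorMonoidIsoOver

variable {C₁ : Type u₁} [Category.{v₁} C₁] {D₁ : Type u₁'} [Category.{v₁'} D₁]
variable {C₂ : Type u₂} [Category.{v₂} C₂] {D₂ : Type u₂'} [Category.{v₂'} D₂]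
variable {C₁' : Type u₃} [Category.{v₃} C₁'] {C₂' : Type u₄} [Category.{v₄} C₂']
variable {S₁ : PreFrobenioidData.{w₁} C₁ D₁} {S₂ : PreFrobenioidData.{w₂} C₂ D₂} {Ψ : C₁ ≌ C₂}
variable {S₁' : PreFrobenioidData.{w₁'} C₁' D₁} {S₂' : PreFrobenioidData.{w₂'} C₂' D₂} {Ψ' : C₁' ≌ C₂'}

/-- **Descent of `Ψ^Φ` along an embedding of divisor monoids, with its defining equation** (FrdI p. 89:
"maps the subset `Φ₁(A₁) ⊆ Φ₁(A₁)^pf` onto the subset `Φ₂(A₂)`, hence determines an isomorphism of monoids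
`Φ₁(A₁) ⥲ Φ₂(A₂)` which is functorial in `A₁`"): the hypotheses are those of seat abc-iut-w4-d109's
`nonempty_of_embedding` verbatim; the conclusion records that the components of the descended `Ψ^Φ` ARE the
restrictions of those of `E'`: `(g_A)^* ι₂(Ψ^Φ_A x) = E'_{I₁ A}((b_A)^* ι₁ x)`. (Proof adapted from
`DivisorMonoidIsoEmbeddingDescent.lean`.) [cite: MochizukiFrdI2008, Thm. 4.9 p.89] -/
theorem exists_of_embedding (I₁ : C₁ ⥤ C₁')
    (b : ∀ A : C₁, S₁'.base.obj (I₁.obj A) ≅ S₁.base.obj A)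
    (hb : ∀ ⦃A B : C₁⦄ (φ : A ⟶ B), (b A).hom ≫ S₁.base.map φ = S₁'.base.map (I₁.map φ) ≫ (b B).hom)
    (g : ∀ A : C₁, S₂'.base.obj (Ψ'.functor.obj (I₁.obj A)) ≅ S₂.base.obj (Ψ.functor.obj A))
    (hg : ∀ ⦃A B : C₁⦄ (φ : A ⟶ B), (g A).hom ≫ S₂.base.map (Ψ.functor.map φ) =
      S₂'.base.map (Ψ'.functor.map (I₁.map φ)) ≫ (g B).hom)
    (ι₁ : ∀ X : D₁, S₁.Mon X →* S₁'.Mon X)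
    (hι₁ : ∀ ⦃X Y : D₁⦄ (f : Y ⟶ X) (x : S₁.Mon X), ι₁ Y (S₁.pull f x) = S₁'.pull f (ι₁ X x))
    (hι₁inj : ∀ X : D₁, Function.Injective (ι₁ X))
    (ι₂ : ∀ X : D₂, S₂.Mon X →* S₂'.Mon X)
    (hι₂ : ∀ ⦃X Y : D₂⦄ (f : Y ⟶ X) (x : S₂.Mon X), ι₂ Y (S₂.pull f x) = S₂'.pull f (ι₂ X x))
    (hι₂inj : ∀ X : D₂, Function.Injective (ι₂ X))
    (E' : DivisorMonoidIsoOver S₁' S₂' Ψ')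
    (himg : ∀ A : C₁,
      (∀ x : S₁.Mon (S₁.base.obj A), ∃ z : S₂.Mon (S₂.base.obj (Ψ.functor.obj A)),
          E'.iso (I₁.obj A) (S₁'.pull (b A).hom (ι₁ _ x)) = S₂'.pull (g A).hom (ι₂ _ z)) ∧
      (∀ z : S₂.Mon (S₂.base.obj (Ψ.functor.obj A)), ∃ x : S₁.Mon (S₁.base.obj A),
          E'.iso (I₁.obj A) (S₁'.pull (b A).hom (ι₁ _ x)) = S₂'.pull (g A).hom (ι₂ _ z))) :
    ∃ E : DivisorMonoidIsoOver S₁ S₂ Ψ, ∀ (A : C₁) (x : S₁.Mon (S₁.base.obj A)),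
      S₂'.pull (g A).hom (ι₂ _ (E.iso A x)) = E'.iso (I₁.obj A) (S₁'.pull (b A).hom (ι₁ _ x)) := by
  classical
  -- the two injective transports into `Φ₂'(Base₂'(Ψ' I₁ A))`
  let t₁ : ∀ A : C₁, S₁.Mon (S₁.base.obj A) → S₂'.Mon (S₂'.base.obj (Ψ'.functor.obj (I₁.obj A))) :=
    fun A x => E'.iso (I₁.obj A) (S₁'.pull (b A).hom (ι₁ _ x))
  let t₂ : ∀ A : C₁, S₂.Mon (S₂.base.obj (Ψ.functor.obj A)) →
      S₂'.Mon (S₂'.base.obj (Ψ'.functor.obj (I₁.obj A))) :=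
    fun A z => S₂'.pull (g A).hom (ι₂ _ z)
  have t₁_mul : ∀ (A : C₁) (x y : S₁.Mon (S₁.base.obj A)), t₁ A (x * y) = t₁ A x * t₁ A y := by
    intro A x y
    simp only [t₁, map_mul]
  have t₂_mul : ∀ (A : C₁) (x y : S₂.Mon (S₂.base.obj (Ψ.functor.obj A))),
      t₂ A (x * y) = t₂ A x * t₂ A y := by
    intro A x y
    simp only [t₂, map_mul]
  -- pull-back along an isomorphism is injective
  have pinj₁ : ∀ {X Y : D₁} (i : Y ≅ X), Function.Injective (S₁'.pull i.hom) := by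
    intro X Y i u v h
    have := congrArg (S₁'.pull i.inv) h
    rwa [← S₁'.pull_comp, ← S₁'.pull_comp, i.inv_hom_id, S₁'.pull_id, S₁'.pull_id] at this
  have pinj₂ : ∀ {X Y : D₂} (i : Y ≅ X), Function.Injective (S₂'.pull i.hom) := by
    intro X Y i u v h
    have := congrArg (S₂'.pull i.inv) h
    rwa [← S₂'.pull_comp, ← S₂'.pull_comp, i.inv_hom_id, S₂'.pull_id, S₂'.pull_id] at this
  have t₁_inj : ∀ A : C₁, Function.Injective (t₁ A) := by
    intro A u v h
    exact hι₁inj _ (pinj₁ (b A) ((E'.iso (I₁.obj A)).injective h))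
  have t₂_inj : ∀ A : C₁, Function.Injective (t₂ A) := by
    intro A u v h
    exact hι₂inj _ (pinj₂ (g A) h)
  -- the component `Ψ^Φ_A` as a function and its inverse, from the image condition
  let f : ∀ A : C₁, S₁.Mon (S₁.base.obj A) → S₂.Mon (S₂.base.obj (Ψ.functor.obj A)) :=
    fun A x => ((himg A).1 x).choose
  have hf : ∀ (A : C₁) (x : S₁.Mon (S₁.base.obj A)), t₂ A (f A x) = t₁ A x :=
    fun A x => (((himg A).1 x).choose_spec).symm
  let fi : ∀ A : C₁, S₂.Mon (S₂.base.obj (Ψ.functor.obj A)) → S₁.Mon (S₁.base.obj A) :=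
    fun A z => ((himg A).2 z).choose
  have hfi : ∀ (A : C₁) (z : S₂.Mon (S₂.base.obj (Ψ.functor.obj A))), t₁ A (fi A z) = t₂ A z :=
    fun A z => ((himg A).2 z).choose_spec
  let e : ∀ A : C₁, S₁.Mon (S₁.base.obj A) ≃* S₂.Mon (S₂.base.obj (Ψ.functor.obj A)) := fun A =>
    { toFun := f A
      invFun := fi A
      left_inv := fun x => t₁_inj A (by rw [hfi, hf])
      right_inv := fun z => t₂_inj A (by rw [hf, hfi])
      map_mul' := fun x y => t₂_inj A (by rw [hf, t₁_mul, t₂_mul, hf, hf]) }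
  refine ⟨⟨e, fun A B φ x => ?_⟩, fun A x => hf A x⟩
  -- naturality, checked after the injective transport `t₂ A`
  show f A (S₁.pull (S₁.base.map φ) x) = S₂.pull (S₂.base.map (Ψ.functor.map φ)) (f B x)
  apply t₂_inj A
  rw [hf]
  have lhs : t₁ A (S₁.pull (S₁.base.map φ) x) =
      S₂'.pull (S₂'.base.map (Ψ'.functor.map (I₁.map φ))) (t₁ B x) := by
    simp only [t₁]
    rw [hι₁, ← S₁'.pull_comp, hb, S₁'.pull_comp]
    exact E'.natural (I₁.map φ) _
  have rhs : t₂ A (S₂.pull (S₂.base.map (Ψ.functor.map φ)) (f B x)) =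
      S₂'.pull (S₂'.base.map (Ψ'.functor.map (I₁.map φ))) (t₂ B (f B x)) := by
    simp only [t₂]
    rw [hι₂, ← S₂'.pull_comp, hg, S₂'.pull_comp]
  rw [lhs, rhs, hf]

end DivisorMonoidIsoOver

end PreFrobenioidData

namespace FrdI.T49

open PreFrobenioidData

variable {D₁ : Type u₁} [Category.{v₁} D₁] {Φ₁ : D₁ᵒᵖ ⥤ CommMonCat.{w₁}}
  {C₁ : Type u₁'} [Category.{v₁'} C₁] {F₁ : C₁ ⥤ ElemFrobenioid Φ₁}
  {D₂ : Type u₂} [Category.{v₂} D₂] {Φ₂ : D₂ᵒᵖ ⥤ CommMonCat.{w₂}}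
  {C₂ : Type u₂'} [Category.{v₂'} C₂] {F₂ : C₂ ⥤ ElemFrobenioid Φ₂}

set_option backward.isDefEq.respectTransparency false in
/-- **Descent of `Ψ^Φ` from the perfections, with its defining equation and the Div clause** (FrdI p. 89
ll. 25–41): hypotheses verbatim those of seat abc-iut-w4-d109's `nonempty_divisorMonoidIsoOver_of_perfection`
(Frobenioids `C_i`; `Ψ` compatible with arrows of Frobenius type, so that `Ψ^pf` is defined; `Ψ⁻¹` preserves
pre-steps; `E' : Φ₁^pf ⥲ Φ₂^pf` over `Ψ^pf` with the right-hand property on pre-steps of `C₁^pf`). Conclusion: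
an isomorphism of functors `Ψ^Φ : Φ₁ ⥲ Φ₂` over `Ψ` whose components are THE RESTRICTIONS of those of `E'`
along `Φ_i ↪ Φ_i^pf` — `(Ψ^Φ_A x)^{1/1} = E'_{(A,1)}(x^{1/1})` — and which therefore computes
`Ψ^Φ_A(Div φ) = Div(Ψ φ)` for every pre-step `φ` of `C₁`. (Proof adapted from `Thm49PerfectionDescent.lean`.)
[cite: MochizukiFrdI2008, Thm. 4.9 p.89] -/
theorem exists_divisorMonoidIsoOver_of_perfection (hF₁ : PreFrobenioid.IsFrobenioid F₁)
    (hF₂ : PreFrobenioid.IsFrobenioid F₂) (Ψ : C₁ ≌ C₂)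
    (hΨ : PreFrobenioid.IsFrobeniusCompatible F₁ F₂ Ψ.functor)
    (hinv : ∀ ⦃X Y : C₂⦄ (g : X ⟶ Y), PreFrobenioid.IsPreStep F₂ g → PreFrobenioid.IsPreStep F₁ (Ψ.inverse.map g))
    (E' : haveI := PreFrobenioid.Perfection.map_isEquivalence (hF₁ := hF₁) (hF₂ := hF₂) Ψ hΨ
      DivisorMonoidIsoOver (PreFrobenioid.Perfection.ops hF₁) (PreFrobenioid.Perfection.ops hF₂)
        (PreFrobenioid.Perfection.map (hF₁ := hF₁) (hF₂ := hF₂) hΨ).asEquivalence)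
    (hE' : ∀ ⦃X Y : PreFrobenioid.Perfection hF₁⦄ (f : X ⟶ Y), (PreFrobenioid.Perfection.ops hF₁).IsPreStep f →
      E'.iso X ((PreFrobenioid.Perfection.ops hF₁).div f) =
        (PreFrobenioid.Perfection.ops hF₂).div ((PreFrobenioid.Perfection.map (hF₁ := hF₁) (hF₂ := hF₂) hΨ).map f)) :
    ∃ E : DivisorMonoidIsoOver (ofFunctor Φ₁ F₁) (ofFunctor Φ₂ F₂) Ψ,
      (∀ (A : C₁) (x : Φ₁.obj (op (PreFrobenioid.baseObj F₁ A))),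
        Perfection.of _ (E.iso A x) = E'.iso ((PreFrobenioid.Perfection.toPf hF₁).obj A) (Perfection.of _ x)) ∧
      ∀ ⦃A B : C₁⦄ (φ : A ⟶ B), PreFrobenioid.IsPreStep F₁ φ →
        E.iso A (PreFrobenioid.Div F₁ φ) = PreFrobenioid.Div F₂ (Ψ.functor.map φ) := by
  haveI := PreFrobenioid.Perfection.map_isEquivalence (hF₁ := hF₁) (hF₂ := hF₂) Ψ hΨ
  have hP₁ := hF₁.isPreFrobenioid
  have hP₂ := hF₂.isPreFrobenioid
  -- the value of `E'` on the image of `Φ₁(A)`: `E'_{(A,1)}(Div(φ)^{1/1}) = Div(Ψ φ)^{1/1}` for pre-steps `φ`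
  have key : ∀ ⦃A B : C₁⦄ (φ : A ⟶ B), PreFrobenioid.IsPreStep F₁ φ →
      E'.iso ((PreFrobenioid.Perfection.toPf hF₁).obj A) (Perfection.of _ (PreFrobenioid.Div F₁ φ)) =
        Perfection.of _ (PreFrobenioid.Div F₂ (Ψ.functor.map φ)) := by
    intro A B φ hφ
    have h := hE' ((PreFrobenioid.Perfection.toPf hF₁).map φ)
      (PreFrobenioid.Perfection.preservesMor_isPreStep hF₁ φ ((ofFunctor_isPreStep F₁ φ).2 hφ))
    rw [PreFrobenioid.Perfection.map_toPf_map hΨ φ] at h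
    change (E'.iso _) (PreFrobenioid.Perfection.Hom.div ((PreFrobenioid.Perfection.toPf hF₁).map φ)) =
      PreFrobenioid.Perfection.Hom.div ((PreFrobenioid.Perfection.toPf hF₂).map (Ψ.functor.map φ)) at h
    rw [PreFrobenioid.Perfection.div_toPf, PreFrobenioid.Perfection.div_toPf] at h
    exact h
  refine (DivisorMonoidIsoOver.exists_of_embedding (S₁ := ofFunctor Φ₁ F₁) (S₂ := ofFunctor Φ₂ F₂)
    (S₁' := PreFrobenioid.Perfection.ops hF₁) (S₂' := PreFrobenioid.Perfection.ops hF₂)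
    (Ψ' := (PreFrobenioid.Perfection.map (hF₁ := hF₁) (hF₂ := hF₂) hΨ).asEquivalence)
    (PreFrobenioid.Perfection.toPf hF₁) (fun A => Iso.refl _) (fun A B φ => ?_) (fun A => Iso.refl _)
    (fun A B φ => ?_)
    (fun X => Perfection.of (Φ₁.obj (op X))) (fun X Y f x => rfl) (perfectionOf_injective hP₁)
    (fun X => Perfection.of (Φ₂.obj (op X))) (fun X Y f x => rfl) (perfectionOf_injective hP₂)
    E' (fun A => ⟨fun x => ?_, fun z => ?_⟩)).elim fun E hE => ?_
  · -- `toPf` lies over the base on the nose (Prop. 3.2 (i))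
    change 𝟙 _ ≫ PreFrobenioid.Base F₁ φ =
      PreFrobenioid.Perfection.Hom.baseMap ((PreFrobenioid.Perfection.toPf hF₁).map φ) ≫ 𝟙 _
    rw [Category.id_comp, Category.comp_id, PreFrobenioid.Perfection.baseMap_toPf]
  · -- `Ψ^pf (toPf φ) = toPf (Ψ φ)` (Thm. 3.4 (iii)) and Prop. 3.2 (i) again
    change 𝟙 _ ≫ PreFrobenioid.Base F₂ (Ψ.functor.map φ) =
      PreFrobenioid.Perfection.Hom.baseMap
        ((PreFrobenioid.Perfection.map (hF₁ := hF₁) (hF₂ := hF₂) hΨ).map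
          ((PreFrobenioid.Perfection.toPf hF₁).map φ)) ≫ 𝟙 _
    rw [Category.id_comp, Category.comp_id]
    exact ((congrArg PreFrobenioid.Perfection.Hom.baseMap (PreFrobenioid.Perfection.map_toPf_map hΨ φ)).trans
      (PreFrobenioid.Perfection.baseMap_toPf (hF := hF₂) (Ψ.functor.map φ))).symm
  · -- `Φ₁(A) → Φ₂(Ψ A)`: `x = Div(φ)` for a pre-step `φ` out of `A` (Def. 1.3 (iii)(d))
    obtain ⟨B, φ, hφ, rfl⟩ := hF₁.iii_d_under_surj A x
    refine ⟨PreFrobenioid.Div F₂ (Ψ.functor.map φ), ?_⟩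
    change E'.iso _ ((PreFrobenioid.Perfection.ops hF₁).pull (𝟙 _) _) =
      (PreFrobenioid.Perfection.ops hF₂).pull (𝟙 _) _
    rw [(PreFrobenioid.Perfection.ops hF₁).pull_id, (PreFrobenioid.Perfection.ops hF₂).pull_id]
    exact key φ hφ.2
  · -- `Φ₂(Ψ A) → Φ₁(A)`: `z = Div(ψ')` for a pre-step `ψ'` out of `Ψ A`; pull it back along `Ψ`
    obtain ⟨B', ψ', hψ', rfl⟩ := hF₂.iii_d_under_surj (Ψ.functor.obj A) z
    obtain ⟨u, hu⟩ : ∃ u : A ≅ Ψ.inverse.obj (Ψ.functor.obj A), u.hom = Ψ.unit.app A :=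
      ⟨Ψ.unitIso.app A, rfl⟩
    obtain ⟨c, hc⟩ : ∃ c : Ψ.functor.obj (Ψ.inverse.obj B') ≅ B', c.inv = Ψ.counitInv.app B' :=
      ⟨Ψ.counitIso.app B', rfl⟩
    obtain ⟨c', hc'⟩ : ∃ c' : Ψ.functor.obj (Ψ.inverse.obj (Ψ.functor.obj A)) ≅ Ψ.functor.obj A,
        c'.hom = Ψ.counit.app (Ψ.functor.obj A) :=
      ⟨Ψ.counitIso.app (Ψ.functor.obj A), rfl⟩
    have hφ : PreFrobenioid.IsPreStep F₁ (u.hom ≫ Ψ.inverse.map ψ') :=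
      PreFrobenioid.IsPreStep.comp F₁ (PreFrobenioid.isPreStep_of_isIso F₁ u.hom) (hinv ψ' hψ'.2)
    have hΨφ : Ψ.functor.map (u.hom ≫ Ψ.inverse.map ψ') = ψ' ≫ c.inv := by
      have h₁ : Ψ.functor.map (Ψ.inverse.map ψ') = c'.hom ≫ ψ' ≫ c.inv := by
        rw [hc, hc']
        exact Ψ.fun_inv_map _ _ ψ'
      have h₂ : Ψ.functor.map u.hom ≫ c'.hom = 𝟙 (Ψ.functor.obj A) := by
        rw [hu, hc']
        exact Ψ.functor_unit_comp A
      rw [Functor.map_comp, h₁, ← Category.assoc, h₂, Category.id_comp]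
    have hdiv : PreFrobenioid.Div F₂ (Ψ.functor.map (u.hom ≫ Ψ.inverse.map ψ')) = PreFrobenioid.Div F₂ ψ' := by
      rw [hΨφ]
      exact div_comp_iso hP₂ ψ' c.inv
    refine ⟨PreFrobenioid.Div F₁ (u.hom ≫ Ψ.inverse.map ψ'), ?_⟩
    change E'.iso _ ((PreFrobenioid.Perfection.ops hF₁).pull (𝟙 _) _) =
      (PreFrobenioid.Perfection.ops hF₂).pull (𝟙 _) _
    rw [(PreFrobenioid.Perfection.ops hF₁).pull_id, (PreFrobenioid.Perfection.ops hF₂).pull_id]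
    exact (key _ hφ).trans (congrArg (Perfection.of _) hdiv)
  · -- the defining equation (the transports along `Iso.refl` are identities) and the Div clause
    have hE₀ : ∀ (A : C₁) (x : Φ₁.obj (op (PreFrobenioid.baseObj F₁ A))),
        Perfection.of _ (E.iso A x) = E'.iso ((PreFrobenioid.Perfection.toPf hF₁).obj A) (Perfection.of _ x) := by
      intro A x
      have h := hE A x
      change (PreFrobenioid.Perfection.ops hF₂).pull (𝟙 _) _ =
        E'.iso _ ((PreFrobenioid.Perfection.ops hF₁).pull (𝟙 _) _) at h
      rwa [(PreFrobenioid.Perfection.ops hF₁).pull_id, (PreFrobenioid.Perfection.ops hF₂).pull_id] at h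
    exact ⟨E, hE₀, fun A B φ hφ => perfectionOf_injective hP₂ _ ((hE₀ A _).trans (key φ hφ))⟩

universe w v v' u u'

variable {D₃ : Type u} [Category.{v} D₃] {Φ₃ : D₃ᵒᵖ ⥤ CommMonCat.{w}} {C₃ : Type u'} [Category.{v'} C₃]
  {D₄ : Type u} [Category.{v} D₄] {Φ₄ : D₄ᵒᵖ ⥤ CommMonCat.{w}} {C₄ : Type u'} [Category.{v'} C₄]

set_option backward.isDefEq.respectTransparency false in
/-- **T49-L01, with its defining equation**: under the hypotheses of seat abc-iut-w4-d109's
`nonempty_divisorMonoidIsoOver_of_isotropic` (Frobenioids; `Ψ` preserving isotropic hulls; a family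
`m_A : Φ₁(A) ≃ Φ₂(Ψ A)` on the ISOTROPIC objects, natural along arrows between isotropic objects), the
extension `Ψ^Φ : Φ₁ ⥲ Φ₂` over `Ψ` (transport along the isotropic hulls `A → A^istr`, Def. 1.3 (vii)(a),
Prop. 1.9 (v)) AGREES WITH `m` ON THE ISOTROPIC OBJECTS: `Ψ^Φ_A = m_A` (for isotropic `A` the hull
`h_A : A → A^istr` is a base-isomorphism along which `m` is natural). (Proof adapted from
`Thm49IsotropicWLOG.lean`.) [cite: MochizukiFrdI2008, Thm. 4.9 p.89] -/
theorem exists_divisorMonoidIsoOver_of_isotropic (F₁ : C₃ ⥤ ElemFrobenioid Φ₃) (F₂ : C₄ ⥤ ElemFrobenioid Φ₄)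
    (Ψ : C₃ ≌ C₄) (hF₁ : PreFrobenioid.IsFrobenioid F₁)
    (hhull : ∀ ⦃A B : C₃⦄ (h : A ⟶ B),
      PreFrobenioid.IsIsotropicHull F₁ h → PreFrobenioid.IsIsotropicHull F₂ (Ψ.functor.map h))
    (m : ∀ A : C₃, PreFrobenioid.IsIsotropic F₁ A →
      (Φ₃.obj (op (PreFrobenioid.baseObj F₁ A)) ≃* Φ₄.obj (op (PreFrobenioid.baseObj F₂ (Ψ.functor.obj A)))))
    (hm : ∀ ⦃A B : C₃⦄ (hA : PreFrobenioid.IsIsotropic F₁ A) (hB : PreFrobenioid.IsIsotropic F₁ B) (φ : A ⟶ B)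
      (x : Φ₃.obj (op (PreFrobenioid.baseObj F₁ B))),
      m A hA (pull Φ₃ (PreFrobenioid.Base F₁ φ) x) =
        pull Φ₄ (PreFrobenioid.Base F₂ (Ψ.functor.map φ)) (m B hB x)) :
    ∃ E : PreFrobenioidData.DivisorMonoidIsoOver (PreFrobenioidData.ofFunctor Φ₃ F₁)
        (PreFrobenioidData.ofFunctor Φ₄ F₂) Ψ,
      ∀ (A : C₃) (hA : PreFrobenioid.IsIsotropic F₁ A) (x : Φ₃.obj (op (PreFrobenioid.baseObj F₁ A))),
        E.iso A x = m A hA x := by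
  -- the isotropic hulls `h_A : A → A^istr` and the invertibility of `Base(h_A)`, `Base(Ψ h_A)`
  have hh : ∀ A : C₃, PreFrobenioid.IsIsotropicHull F₁ (PreFrobenioid.hullHom hF₁ A) :=
    fun A => PreFrobenioid.isIsotropicHull_hullHom hF₁ A
  have hA' : ∀ A : C₃, PreFrobenioid.IsIsotropic F₁ (PreFrobenioid.hullObj hF₁ A) := fun A => (hh A).2.2.1
  haveI i₁ : ∀ A : C₃, IsIso (PreFrobenioid.Base F₁ (PreFrobenioid.hullHom hF₁ A)) := fun A => (hh A).2.1.2
  haveI i₂ : ∀ A : C₃, IsIso (PreFrobenioid.Base F₂ (Ψ.functor.map (PreFrobenioid.hullHom hF₁ A))) :=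
    fun A => (hhull _ (hh A)).2.1.2
  -- the component at `A` and its inverse
  let f : ∀ A : C₃,
      Φ₃.obj (op (PreFrobenioid.baseObj F₁ A)) →* Φ₄.obj (op (PreFrobenioid.baseObj F₂ (Ψ.functor.obj A))) :=
    fun A => (pull Φ₄ (PreFrobenioid.Base F₂ (Ψ.functor.map (PreFrobenioid.hullHom hF₁ A)))).comp
      ((m _ (hA' A)).toMonoidHom.comp (pull Φ₃ (inv (PreFrobenioid.Base F₁ (PreFrobenioid.hullHom hF₁ A)))))
  let g : ∀ A : C₃,
      Φ₄.obj (op (PreFrobenioid.baseObj F₂ (Ψ.functor.obj A))) →* Φ₃.obj (op (PreFrobenioid.baseObj F₁ A)) :=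
    fun A => (pull Φ₃ (PreFrobenioid.Base F₁ (PreFrobenioid.hullHom hF₁ A))).comp
      ((m _ (hA' A)).symm.toMonoidHom.comp
        (pull Φ₄ (inv (PreFrobenioid.Base F₂ (Ψ.functor.map (PreFrobenioid.hullHom hF₁ A))))))
  have hgf : ∀ A, (g A).comp (f A) = MonoidHom.id _ := fun A => MonoidHom.ext fun x => by
    show pull Φ₃ _ ((m _ (hA' A)).symm (pull Φ₄ _ (pull Φ₄ _ ((m _ (hA' A)) (pull Φ₃ _ x))))) = x
    rw [← pull_comp, IsIso.inv_hom_id, pull_id, MulEquiv.symm_apply_apply, ← pull_comp, IsIso.hom_inv_id,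
      pull_id]
  have hfg : ∀ A, (f A).comp (g A) = MonoidHom.id _ := fun A => MonoidHom.ext fun y => by
    show pull Φ₄ _ ((m _ (hA' A)) (pull Φ₃ _ (pull Φ₃ _ ((m _ (hA' A)).symm (pull Φ₄ _ y))))) = y
    rw [← pull_comp, IsIso.inv_hom_id, pull_id, MulEquiv.apply_symm_apply, ← pull_comp, IsIso.hom_inv_id,
      pull_id]
  refine ⟨⟨fun A => MonoidHom.toMulEquiv (f A) (g A) (hgf A) (hfg A), fun A B φ x => ?_⟩, fun A hA x => ?_⟩
  · -- naturality: `Ψ^Φ_A (Base(φ)^* x) = Base(Ψ φ)^* (Ψ^Φ_B x)`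
    show f A (pull Φ₃ (PreFrobenioid.Base F₁ φ) x) = pull Φ₄ (PreFrobenioid.Base F₂ (Ψ.functor.map φ)) (f B x)
    show pull Φ₄ _ ((m _ (hA' A)) (pull Φ₃ _ (pull Φ₃ (PreFrobenioid.Base F₁ φ) x))) =
      pull Φ₄ _ (pull Φ₄ _ ((m _ (hA' B)) (pull Φ₃ _ x)))
    have e1 : inv (PreFrobenioid.Base F₁ (PreFrobenioid.hullHom hF₁ A)) ≫ PreFrobenioid.Base F₁ φ =
        PreFrobenioid.Base F₁ (PreFrobenioid.hullMor hF₁ φ) ≫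
          inv (PreFrobenioid.Base F₁ (PreFrobenioid.hullHom hF₁ B)) := by
      rw [PreFrobenioid.base_hullMor hF₁ φ, Category.assoc, Category.assoc, IsIso.hom_inv_id, Category.comp_id]
    have e2 : PreFrobenioid.Base F₂ (Ψ.functor.map (PreFrobenioid.hullHom hF₁ A)) ≫
        PreFrobenioid.Base F₂ (Ψ.functor.map (PreFrobenioid.hullMor hF₁ φ)) =
          PreFrobenioid.Base F₂ (Ψ.functor.map φ) ≫
            PreFrobenioid.Base F₂ (Ψ.functor.map (PreFrobenioid.hullHom hF₁ B)) := by
      rw [← PreFrobenioid.base_comp, ← Ψ.functor.map_comp, PreFrobenioid.hullHom_hullMor hF₁ φ,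
        Ψ.functor.map_comp, PreFrobenioid.base_comp]
    rw [← pull_comp, e1, pull_comp, hm (hA' A) (hA' B) (PreFrobenioid.hullMor hF₁ φ), ← pull_comp, e2,
      pull_comp]
    rfl
  · -- agreement with `m` at an isotropic `A`: `m` is natural along the hull `h_A : A → A^istr`
    show f A x = m A hA x
    show pull Φ₄ _ ((m _ (hA' A)) (pull Φ₃ _ x)) = m A hA x
    have h := hm hA (hA' A) (PreFrobenioid.hullHom hF₁ A)
      (pull Φ₃ (inv (PreFrobenioid.Base F₁ (PreFrobenioid.hullHom hF₁ A))) x)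
    rw [← pull_comp, IsIso.hom_inv_id, pull_id] at h
    exact h.symm

set_option backward.isDefEq.respectTransparency false in
/-- **The Div clause descends along the isotropic hulls**: if `Ψ` preserves isotropic hulls and `Ψ^Φ` over
`Ψ` agrees on the isotropic objects with a family `m` computing `m_A(Div φ) = Div(Ψ φ)` for pre-steps `φ`
between ISOTROPIC objects, then `Ψ^Φ_A(Div φ) = Div(Ψ φ)` for every pre-step `φ : A → B` of `C₁` — by
`h_A ≫ φ^istr = φ ≫ h_B` (Prop. 1.9 (v)), `Div(φ^istr) = (Base h_A)⁻¹^* Div(φ)`, the hulls `h`, `Ψ h` being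
isometric pre-steps (Def. 1.3 (vii)) and Rem. 1.1.1. [cite: MochizukiFrdI2008, Thm. 4.9 p.89] -/
theorem iso_div_of_agree_isotropic (F₁ : C₃ ⥤ ElemFrobenioid Φ₃) (F₂ : C₄ ⥤ ElemFrobenioid Φ₄)
    (Ψ : C₃ ≌ C₄) (hF₁ : PreFrobenioid.IsFrobenioid F₁)
    (hhull : ∀ ⦃A B : C₃⦄ (h : A ⟶ B),
      PreFrobenioid.IsIsotropicHull F₁ h → PreFrobenioid.IsIsotropicHull F₂ (Ψ.functor.map h))
    (m : ∀ A : C₃, PreFrobenioid.IsIsotropic F₁ A →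
      (Φ₃.obj (op (PreFrobenioid.baseObj F₁ A)) ≃* Φ₄.obj (op (PreFrobenioid.baseObj F₂ (Ψ.functor.obj A)))))
    (hmdiv : ∀ ⦃A B : C₃⦄ (hA : PreFrobenioid.IsIsotropic F₁ A) (_hB : PreFrobenioid.IsIsotropic F₁ B)
      (φ : A ⟶ B), PreFrobenioid.IsPreStep F₁ φ →
        m A hA (PreFrobenioid.Div F₁ φ) = PreFrobenioid.Div F₂ (Ψ.functor.map φ))
    (E : PreFrobenioidData.DivisorMonoidIsoOver (PreFrobenioidData.ofFunctor Φ₃ F₁)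
      (PreFrobenioidData.ofFunctor Φ₄ F₂) Ψ)
    (hE : ∀ (A : C₃) (hA : PreFrobenioid.IsIsotropic F₁ A) (x : Φ₃.obj (op (PreFrobenioid.baseObj F₁ A))),
      E.iso A x = m A hA x)
    ⦃A B : C₃⦄ (φ : A ⟶ B) (hφ : PreFrobenioid.IsPreStep F₁ φ) :
    E.iso A (PreFrobenioid.Div F₁ φ) = PreFrobenioid.Div F₂ (Ψ.functor.map φ) := by
  have hh : ∀ A : C₃, PreFrobenioid.IsIsotropicHull F₁ (PreFrobenioid.hullHom hF₁ A) :=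
    fun A => PreFrobenioid.isIsotropicHull_hullHom hF₁ A
  haveI : IsIso (PreFrobenioid.Base F₁ (PreFrobenioid.hullHom hF₁ A)) := (hh A).2.1.2
  -- `Div φ = (Base h_A)^* Div(φ^istr)`
  have h1 : PreFrobenioid.Div F₁ φ = pull Φ₃ (PreFrobenioid.Base F₁ (PreFrobenioid.hullHom hF₁ A))
      (PreFrobenioid.Div F₁ (PreFrobenioid.hullMor hF₁ φ)) := by
    rw [PreFrobenioid.div_hullMor hF₁ φ, ← pull_comp, IsIso.hom_inv_id, pull_id]
  -- `Div(Ψ φ) = (Base Ψ h_A)^* Div(Ψ φ^istr)`: both equal `Div(Ψ (h_A ≫ φ^istr)) = Div(Ψ (φ ≫ h_B))`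
  have hΨA := hhull _ (hh A)
  have hΨB := hhull _ (hh B)
  have h2 : PreFrobenioid.Div F₂ (Ψ.functor.map φ) =
      pull Φ₄ (PreFrobenioid.Base F₂ (Ψ.functor.map (PreFrobenioid.hullHom hF₁ A)))
        (PreFrobenioid.Div F₂ (Ψ.functor.map (PreFrobenioid.hullMor hF₁ φ))) := by
    have h := congrArg (fun k => PreFrobenioid.Div F₂ (Ψ.functor.map k)) (PreFrobenioid.hullHom_hullMor hF₁ φ)
    simp only [Functor.map_comp] at h
    rw [PreFrobenioid.div_comp, PreFrobenioid.div_comp, show PreFrobenioid.Div F₂ (Ψ.functor.map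
        (PreFrobenioid.hullHom hF₁ A)) = 1 from hΨA.1, one_pow, mul_one,
      show PreFrobenioid.Div F₂ (Ψ.functor.map (PreFrobenioid.hullHom hF₁ B)) = 1 from hΨB.1, map_one, one_mul,
      show PreFrobenioid.degFr F₂ (Ψ.functor.map (PreFrobenioid.hullHom hF₁ B)) = 1 from hΨB.2.1.1,
      PNat.one_coe, pow_one] at h
    exact h.symm
  rw [h1, h2, ← hmdiv (hh A).2.2.1 (hh B).2.2.1 (PreFrobenioid.hullMor hF₁ φ)
    (PreFrobenioid.isPreStep_hullMor hF₁ φ hφ), ← hE _ (hh A).2.2.1]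
  exact E.natural (PreFrobenioid.hullHom hF₁ A) _

end FrdI.T49

end Literature.AlgebraicGeometry.Frobenioids
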